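import Literature.NumberTheory.CubicFields.CubicFieldDiscriminant307ClassNumber
import HarnessLib

/-!
# The cubic field of discriminant `−1259`: `F = ℚ(θ)`, `f(θ) = 0`, `f = X³ − 5X² − 1X − 2` — `𝓞_F = ℤ[θ]`, `d_F = −1259`,
# signature `(1, 1)`, the primes of norm `≤ 10`, and CLASS NUMBER ONE (LMFDB number field 3.1.1259.1) — PROVED

Topic `Literature/NumberTheory/CubicFields`, namespace `Literature.NumberTheory.CubicFields.CubicDisc1259` (the object: the cubic field of
discriminant `−1259`; same template as `CubicFieldDiscriminant307ClassNumber.lean` / `…139…` / `…1763…` of the same seat lineage (att-p4 g27/g28)).  THEOREMS ONLY (no definition,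
no named fact, no instance, no notation); every statement is PROVED.  Written by the prover seat `bsd-line-att-p4` g38 (cell `bsd-f1-sign2`; template and toolkit of g27) so
that the displayed datum «`h(ℚ(β))` odd» / «`h(ℚ(β)) = 1`» of the `2`-adic class-group doors of crux C2 of route `AlignedTransportAtTwo`
(att-p3's depth door, layer-one unit door and genus-character certificate; att-p5's cubic Chevalley doors) is a kernel theorem for the
curve `[1,−1,1,−3,−2]` of conductor `1259 (prime)` (rank 0, L/Ω = 1) on the sub-cell `Δ_min ≡ 5 (mod 8)`, `σ₁(ε) ≡ ±1 (mod 8)` (classes u1/u7 of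
att-p5 g31's / att-p3 g41's census, where the unit-sign doors are dead): `ℚ(β)` (`u = 4β` a root of `c_W = u³ − 3u² − 40u − 112`) has discriminant
`−1259`, squarefree, so it is THIS field — the number of cubic fields of a fundamental discriminant `D < 0` is `(#Cl(ℚ(√D))[3] − 1)/2`, here `1`
(`h(ℚ(√−1259)) = 15`, `3`-rank `1`); the model `θ = (−4 + u + u²)/16 ∈ ℚ(β)`, a root of `f`, is exhibited downstream (Summits row), not here.

## Source

[LMFDB] The L-functions and Modular Forms Database, number field `3.1.1259.1`: degree `3`, signature `[1, 1]`, discriminant `−1259`, **class number `1`**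
(table entries). D. A. Marcus, *Number Fields*, 2nd ed. (2018) [Marcus2018], Ch. 2 Ex. 27 (index criterion), Ch. 3 Thm. 27 (Dedekind–Kummer),
Ch. 5 Thm. 37 and Cor. 2 (the class group is generated by the primes of norm at most the Minkowski bound).

## Carrier

`F` is ANY number field with `[F : ℚ] = 3` containing `α` with `aeval α f = 0` for the tree's `f = MonicCubic.poly (-5) (-1) (-2) ∈ ℤ[X]`
(every model of the cubic field of discriminant `−1259`).  `θ := MonicCubic.thetaInt hα ∈ 𝓞 F`.

## What is formalised (all PROVED)

* §1 the polynomial: `disc_eq` (`Δ(f) = −1259`, squarefree), `isUnit_of_disc_eq_sq_mul`, `no_root_3` / `irreducible_polyQ` (no root mod `3`),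
  `polyMod_eq` and the factorisations `polyMod_<p>` of `f mod p` for the split primes `p ≤ 10`.
* §2 the field: `discr_eq` (**`d_F = −1259`**), `adjoin_thetaInt_eq_top` (**`𝓞_F = ℤ[θ]`**), `nrComplexPlaces_eq_one` (**signature `(1, 1)`**).
* §3 every prime of `𝓞_F` above a prime `p ≤ 10` with `p^f ≤ 10` is principal, by EXPLICIT GENERATORS (pure ideal arithmetic from `f(θ) = 0`)
  or because `p` is inert (`isPrincipal_of_mem_primesOver_<p>`).
* §4 ★ **`h_F = 1`** (`isPrincipalIdealRing`, `classNumber_eq_one`; Minkowski `(4/π)(3!/3³)√1259 ≈ 10.04 < 11`, Mathlib's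
  `RingOfIntegers.isPrincipalIdealRing_of_isPrincipal_of_pow_le_of_mem_primesOver_of_mem_Icc`) and `not_two_dvd_classNumber`.

## References
* [LMFDB] The LMFDB Collaboration, The L-functions and Modular Forms Database, number field 3.1.1259.1.
* [Marcus2018] D. A. Marcus, *Number Fields*, 2nd ed., Universitext, Springer 2018, Ch. 2 Ex. 27, Ch. 3 Thm. 27, Ch. 5 Thm. 37.
-/

noncomputable section

open Polynomial NumberField NumberField.InfinitePlace Ideal Module Real
open Literature.NumberTheory.NumberFields
open Literature.NumberTheory.NumberFields.MonicCubic

namespace Literature.NumberTheory.CubicFields.CubicDisc1259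

/-! ## §1 The polynomial `f = MonicCubic.poly (-5) (-1) (-2)` -/

/-- `Δ(f) = −1259`. [cite: LMFDB, number field 3.1.1259.1 (discriminant −1259)] -/
theorem disc_eq : disc (-5) (-1) (-2) = -1259 := by
  norm_num [disc]

/-- The square-factor condition of the tree's index criterion for `f`: `−1259 = r²e` with `|e| > 2` forces `r = ±1`
(`1259` is squarefree). [cite: Marcus2018, Ch. 2, Exercise 27] -/
theorem isUnit_of_disc_eq_sq_mul : ∀ r e : ℤ, disc (-5) (-1) (-2) = r ^ 2 * e → 2 < |e| → IsUnit r := by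
  intro r e h _
  rw [disc_eq] at h
  have hdvd : r.natAbs ^ 2 ∣ 1259 := by
    have h1 : r ^ 2 ∣ (1259 : ℤ) := ⟨-e, by linear_combination -h⟩
    have h2 : ((r.natAbs ^ 2 : ℕ) : ℤ) ∣ (1259 : ℕ) := by
      rw [Nat.cast_pow, Int.natCast_natAbs, sq_abs]; exact_mod_cast h1
    exact Int.natCast_dvd_natCast.mp h2
  have hle : r.natAbs ≤ 36 := by
    have := Nat.le_of_dvd (by norm_num) hdvd
    nlinarith
  rw [Int.isUnit_iff_natAbs_eq]
  interval_cases hr : r.natAbs <;> omega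

/-- `f` has no root modulo `3`. [cite: Marcus2018, Ch. 3, Thm. 27] -/
theorem no_root_3 :
    ∀ r : ZMod 3, r ^ 3 + ((-5 : ℤ) : ZMod 3) * r ^ 2 + ((-1 : ℤ) : ZMod 3) * r + ((-2 : ℤ) : ZMod 3) ≠ 0 := by
  decide

/-- **`f` is irreducible over `ℚ`** (no root modulo `3`; the tree's `irreducible_polyQ_of_no_root`). [cite: LMFDB, number field 3.1.1259.1 (degree 3)] -/
theorem irreducible_polyQ : Irreducible (polyQ (-5) (-1) (-2)) :=
  haveI : Fact (Nat.Prime 3) := ⟨by norm_num⟩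
  irreducible_polyQ_of_no_root 3 no_root_3

/-- `f mod p` written out. [cite: Marcus2018, Ch. 3, Thm. 27] -/
theorem polyMod_eq (p : ℕ) : polyMod (-5) (-1) (-2) p = ((-2) + (-1) * X + (-5) * X ^ 2 + X ^ 3 : (ZMod p)[X]) := by
  simp [polyMod, poly]; ring

/-- The factorisation of `f` modulo `2`. [cite: Marcus2018, Ch. 3, Thm. 27] -/
theorem polyMod_2 : polyMod (-5) (-1) (-2) 2 = X * (X ^ 2 + X + 1) := by
  rw [polyMod_eq]
  have hp : (2 : (ZMod 2)[X]) = 0 := by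
    rw [show (2 : (ZMod 2)[X]) = C 2 from (map_natCast C 2).symm, show (2 : ZMod 2) = 0 from rfl, C_0]
  linear_combination ((-1) + (-1) * X + (-3) * X ^ 2 : (ZMod 2)[X]) * hp

/-- The factorisation of `f` modulo `7`. [cite: Marcus2018, Ch. 3, Thm. 27] -/
theorem polyMod_7 : polyMod (-5) (-1) (-2) 7 = (X + 6) * (X + 2) * (X + 1) := by
  rw [polyMod_eq]
  have hp : (7 : (ZMod 7)[X]) = 0 := by
    rw [show (7 : (ZMod 7)[X]) = C 7 from (map_natCast C 7).symm, show (7 : ZMod 7) = 0 from rfl, C_0]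
  linear_combination ((-2) + (-3) * X + (-2) * X ^ 2 : (ZMod 7)[X]) * hp

/-! ## §2 The field `F`: `d_F = −1259`, `𝓞_F = ℤ[θ]`, signature `(1, 1)` -/

section NumberField

variable {F : Type*} [Field F] [NumberField F] {α : F}

/-- **`d_F = −1259`** (index criterion: `Δ(f)` squarefree, so `1, α, α²` is an integral basis). [cite: LMFDB, number field 3.1.1259.1 (discriminant −1259)]
[cite: Marcus2018, Ch. 2, Exercise 27] -/
theorem discr_eq (h3 : finrank ℚ F = 3) (hα : aeval α (poly (-5) (-1) (-2)) = 0) : discr F = -1259 := by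
  rw [discr_eq_disc irreducible_polyQ hα h3 isUnit_of_disc_eq_sq_mul, disc_eq]

/-- **`𝓞_F = ℤ[θ]`** (inside `𝓞_F`). [cite: Marcus2018, Ch. 2, Exercise 27] -/
theorem adjoin_thetaInt_eq_top (h3 : finrank ℚ F = 3) (hα : aeval α (poly (-5) (-1) (-2)) = 0) :
    Algebra.adjoin ℤ ({thetaInt hα} : Set (𝓞 F)) = ⊤ :=
  MonicCubic.adjoin_thetaInt_eq_top irreducible_polyQ hα h3 isUnit_of_disc_eq_sq_mul

/-- **`F` has exactly one complex place** (`r₂ = 1`): `d_F < 0` has sign `(−1)^{r₂}`, and `r₁ + 2r₂ = 3`. [cite: LMFDB, number field 3.1.1259.1 (signature [1,1])] -/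
theorem nrComplexPlaces_eq_one (h3 : finrank ℚ F = 3) (hα : aeval α (poly (-5) (-1) (-2)) = 0) : nrComplexPlaces F = 1 := by
  have hsum := card_add_two_mul_card_eq_rank F
  rw [h3] at hsum
  have hsign := NumberField.sign_discr F
  rw [discr_eq h3 hα] at hsign
  have hle : nrComplexPlaces F ≤ 1 := by omega
  rcases Nat.le_one_iff_eq_zero_or_eq_one.mp hle with h0 | h1
  · rw [h0, pow_zero, show (-1259 : ℤ).sign = -1 from rfl] at hsign
    norm_num at hsign
  · exact h1


/-! ## §3 The primes of norm `≤ 10` are principal -/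

/-- The cubic relation `θ³ + aθ² + bθ + c = 0` in `𝓞_F`, numerals pushed (private helper). [folklore] -/
private theorem theta_rel (hα : aeval α (poly (-5) (-1) (-2)) = 0) :
    thetaInt hα ^ 3 + (-5) * thetaInt hα ^ 2 + (-1) * thetaInt hα + (-2) = 0 := by
  have h := thetaInt_rel hα
  push_cast at h
  linear_combination h

/-- `(2, θ + 0) = (-θ)` (an element of norm `±2`). [cite: Marcus2018, Ch. 3, Thm. 27] -/
theorem span_2_lin0_eq (hα : aeval α (poly (-5) (-1) (-2)) = 0) :
    span {(2 : 𝓞 F), thetaInt hα} = span {-thetaInt hα} := by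
  have hrel := theta_rel hα
  apply le_antisymm
  · rw [span_le]
    rintro x hx
    rcases hx with rfl | hx
    · exact mem_span_singleton'.mpr ⟨1 + 5 * thetaInt hα - thetaInt hα ^ 2, by linear_combination (1) * hrel⟩
    · rw [Set.mem_singleton_iff.mp hx]
      exact mem_span_singleton'.mpr ⟨-1, by linear_combination ((0 : 𝓞 F)) * hrel⟩
  · rw [span_singleton_le_iff_mem, mem_span_pair]
    exact ⟨5 + 5 * thetaInt hα + 15 * thetaInt hα ^ 2, -6 - 5 * thetaInt hα - 5 * thetaInt hα ^ 2, by linear_combination (-5) * hrel⟩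

/-- `(2, θ² + 1θ + 1) = (-1 - θ - 3 * θ ^ 2)` (an element of norm `4`). [cite: Marcus2018, Ch. 3, Thm. 27] -/
theorem span_2_quad_eq (hα : aeval α (poly (-5) (-1) (-2)) = 0) :
    span {(2 : 𝓞 F), thetaInt hα ^ 2 + thetaInt hα + 1} = span {-1 - thetaInt hα - 3 * thetaInt hα ^ 2} := by
  have hrel := theta_rel hα
  apply le_antisymm
  · rw [span_le]
    rintro x hx
    rcases hx with rfl | hx
    · exact mem_span_singleton'.mpr ⟨8 + 9 * thetaInt hα - 2 * thetaInt hα ^ 2, by linear_combination (5 + 6 * thetaInt hα) * hrel⟩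
    · rw [Set.mem_singleton_iff.mp hx]
      exact mem_span_singleton'.mpr ⟨1 + 5 * thetaInt hα - thetaInt hα ^ 2, by linear_combination (1 + 3 * thetaInt hα) * hrel⟩
  · rw [span_singleton_le_iff_mem, mem_span_pair]
    exact ⟨44 + 32 * thetaInt hα + 115 * thetaInt hα ^ 2, -5 - 6 * thetaInt hα - 6 * thetaInt hα ^ 2, by linear_combination (-42 - 6 * thetaInt hα) * hrel⟩

/-- **Every prime of `𝓞_F` above `2` is principal** (Dedekind–Kummer with `polyMod_2` and the generators above).
[cite: Marcus2018, Ch. 3, Thm. 27] [cite: LMFDB, number field 3.1.1259.1 (class number 1)] -/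
theorem isPrincipal_of_mem_primesOver_2 (h3 : finrank ℚ F = 3) (hα : aeval α (poly (-5) (-1) (-2)) = 0) {P : Ideal (𝓞 F)}
    (hP : P ∈ primesOver (span {((2 : ℕ) : ℤ)}) (𝓞 F)) : Submodule.IsPrincipal P := by
  haveI : Fact (Nat.Prime 2) := ⟨by norm_num⟩
  obtain ⟨Qb, hirr, hmon, hdvd, -, hspan⟩ :=
    exists_factor_of_mem_primesOver irreducible_polyQ hα h3 isUnit_of_disc_eq_sq_mul (by norm_num : Nat.Prime 2) hP
  rw [polyMod_2] at hdvd
  rcases hirr.prime.dvd_or_dvd hdvd with h | h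
  · have hQb : Qb = X := eq_of_monic_of_associated hmon monic_X (hirr.associated_of_dvd irreducible_X h)
    have hPeq := hspan X (by rw [hQb, Polynomial.map_X])
    rw [aeval_X, Nat.cast_ofNat, span_2_lin0_eq hα] at hPeq
    exact ⟨⟨-thetaInt hα, by rw [hPeq, Ideal.submodule_span_eq]⟩⟩
  · have hQb : Qb = X ^ 2 + X + 1 :=
      eq_of_monic_of_associated hmon (by monicity!) (hirr.associated_of_dvd CubicDisc307.irreducible_quad_two h)
    have hPeq := hspan (X ^ 2 + X + 1) (by rw [hQb]; simp)
    rw [show aeval (thetaInt hα) (X ^ 2 + X + 1 : ℤ[X]) = thetaInt hα ^ 2 + thetaInt hα + 1 by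
        simp only [map_add, map_pow, aeval_X, map_one], Nat.cast_ofNat, span_2_quad_eq hα] at hPeq
    exact ⟨⟨-1 - thetaInt hα - 3 * thetaInt hα ^ 2, by rw [hPeq, Ideal.submodule_span_eq]⟩⟩

/-- **Every prime of `𝓞_F` above `3` is principal**: `3` is inert, the prime is `(3)`. [cite: Marcus2018, Ch. 3, Thm. 27] -/
theorem isPrincipal_of_mem_primesOver_3 (h3 : finrank ℚ F = 3) (hα : aeval α (poly (-5) (-1) (-2)) = 0) {P : Ideal (𝓞 F)}
    (hP : P ∈ primesOver (span {((3 : ℕ) : ℤ)}) (𝓞 F)) : Submodule.IsPrincipal P := by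
  have hPeq := eq_span_of_no_root irreducible_polyQ hα h3 isUnit_of_disc_eq_sq_mul (by norm_num : Nat.Prime 3) hP no_root_3
  exact ⟨⟨((3 : ℕ) : 𝓞 F), by rw [hPeq, Ideal.submodule_span_eq]⟩⟩

/-- `f` has no root modulo `5`: `5` is inert. [cite: Marcus2018, Ch. 3, Thm. 27] -/
theorem no_root_5' : ∀ r : ZMod 5, r ^ 3 + ((-5 : ℤ) : ZMod 5) * r ^ 2 + ((-1 : ℤ) : ZMod 5) * r + ((-2 : ℤ) : ZMod 5) ≠ 0 := by
  decide

/-- **Every prime of `𝓞_F` above `5` is principal**: `5` is inert, the prime is `(5)`. [cite: Marcus2018, Ch. 3, Thm. 27] -/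
theorem isPrincipal_of_mem_primesOver_5 (h3 : finrank ℚ F = 3) (hα : aeval α (poly (-5) (-1) (-2)) = 0) {P : Ideal (𝓞 F)}
    (hP : P ∈ primesOver (span {((5 : ℕ) : ℤ)}) (𝓞 F)) : Submodule.IsPrincipal P := by
  have hPeq := eq_span_of_no_root irreducible_polyQ hα h3 isUnit_of_disc_eq_sq_mul (by norm_num : Nat.Prime 5) hP no_root_5'
  exact ⟨⟨((5 : ℕ) : 𝓞 F), by rw [hPeq, Ideal.submodule_span_eq]⟩⟩

/-- `(7, θ + 6) = (-1 + θ)` (an element of norm `±7`). [cite: Marcus2018, Ch. 3, Thm. 27] -/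
theorem span_7_lin6_eq (hα : aeval α (poly (-5) (-1) (-2)) = 0) :
    span {(7 : 𝓞 F), thetaInt hα + 6} = span {-1 + thetaInt hα} := by
  have hrel := theta_rel hα
  apply le_antisymm
  · rw [span_le]
    rintro x hx
    rcases hx with rfl | hx
    · exact mem_span_singleton'.mpr ⟨-5 - 4 * thetaInt hα + thetaInt hα ^ 2, by linear_combination (1) * hrel⟩
    · rw [Set.mem_singleton_iff.mp hx]
      exact mem_span_singleton'.mpr ⟨-4 - 4 * thetaInt hα + thetaInt hα ^ 2, by linear_combination (1) * hrel⟩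
  · rw [span_singleton_le_iff_mem, mem_span_pair]
    exact ⟨5 + thetaInt hα, -6, by linear_combination ((0 : 𝓞 F)) * hrel⟩

/-- `(7, θ + 2) = (-1 - θ - 2 * θ ^ 2)` (an element of norm `±7`). [cite: Marcus2018, Ch. 3, Thm. 27] -/
theorem span_7_lin2_eq (hα : aeval α (poly (-5) (-1) (-2)) = 0) :
    span {(7 : 𝓞 F), thetaInt hα + 2} = span {-1 - thetaInt hα - 2 * thetaInt hα ^ 2} := by
  have hrel := theta_rel hα
  apply le_antisymm
  · rw [span_le]
    rintro x hx
    rcases hx with rfl | hx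
    · exact mem_span_singleton'.mpr ⟨-9 + 28 * thetaInt hα - 5 * thetaInt hα ^ 2, by linear_combination (-1 + 10 * thetaInt hα) * hrel⟩
    · rw [Set.mem_singleton_iff.mp hx]
      exact mem_span_singleton'.mpr ⟨-4 + 6 * thetaInt hα - thetaInt hα ^ 2, by linear_combination (-1 + 2 * thetaInt hα) * hrel⟩
  · rw [span_singleton_le_iff_mem, mem_span_pair]
    exact ⟨3 + 2 * thetaInt hα + 5 * thetaInt hα ^ 2, -6 - 2 * thetaInt hα - 5 * thetaInt hα ^ 2, by linear_combination (-5) * hrel⟩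

/-- `(7, θ + 1) = (-1 - θ)` (an element of norm `±7`). [cite: Marcus2018, Ch. 3, Thm. 27] -/
theorem span_7_lin1_eq (hα : aeval α (poly (-5) (-1) (-2)) = 0) :
    span {(7 : 𝓞 F), thetaInt hα + 1} = span {-1 - thetaInt hα} := by
  have hrel := theta_rel hα
  apply le_antisymm
  · rw [span_le]
    rintro x hx
    rcases hx with rfl | hx
    · exact mem_span_singleton'.mpr ⟨-5 + 6 * thetaInt hα - thetaInt hα ^ 2, by linear_combination (1) * hrel⟩
    · rw [Set.mem_singleton_iff.mp hx]
      exact mem_span_singleton'.mpr ⟨-1, by linear_combination ((0 : 𝓞 F)) * hrel⟩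
  · rw [span_singleton_le_iff_mem, mem_span_pair]
    exact ⟨1 + thetaInt hα + thetaInt hα ^ 2, -6 - thetaInt hα - thetaInt hα ^ 2, by linear_combination (-1) * hrel⟩

/-- **Every prime of `𝓞_F` above `7` is principal** (Dedekind–Kummer with `polyMod_7` and the generators above).
[cite: Marcus2018, Ch. 3, Thm. 27] [cite: LMFDB, number field 3.1.1259.1 (class number 1)] -/
theorem isPrincipal_of_mem_primesOver_7 (h3 : finrank ℚ F = 3) (hα : aeval α (poly (-5) (-1) (-2)) = 0) {P : Ideal (𝓞 F)}
    (hP : P ∈ primesOver (span {((7 : ℕ) : ℤ)}) (𝓞 F)) : Submodule.IsPrincipal P := by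
  haveI : Fact (Nat.Prime 7) := ⟨by norm_num⟩
  obtain ⟨Qb, hirr, hmon, hdvd, -, hspan⟩ :=
    exists_factor_of_mem_primesOver irreducible_polyQ hα h3 isUnit_of_disc_eq_sq_mul (by norm_num : Nat.Prime 7) hP
  rw [polyMod_7] at hdvd
  rcases hirr.prime.dvd_or_dvd hdvd with h12 | h
  · rcases hirr.prime.dvd_or_dvd h12 with h | h
    · have hirr1 : Irreducible (X + 6 : (ZMod 7)[X]) := by
        rw [show (X + 6 : (ZMod 7)[X]) = X - C (-6) by rw [map_neg, map_ofNat]; ring]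
        exact irreducible_X_sub_C _
      have hQb : Qb = X + 6 := eq_of_monic_of_associated hmon (by monicity!) (hirr.associated_of_dvd hirr1 h)
      have hPeq := hspan (X + C 6) (by rw [hQb]; simp [map_ofNat])
      rw [show aeval (thetaInt hα) (X + C 6 : ℤ[X]) = thetaInt hα + 6 by
          simp only [map_add, aeval_X, aeval_C, algebraMap_int_eq, Int.coe_castRingHom, Int.cast_ofNat], Nat.cast_ofNat, span_7_lin6_eq hα] at hPeq
      exact ⟨⟨-1 + thetaInt hα, by rw [hPeq, Ideal.submodule_span_eq]⟩⟩
    · have hirr1 : Irreducible (X + 2 : (ZMod 7)[X]) := by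
        rw [show (X + 2 : (ZMod 7)[X]) = X - C (-2) by rw [map_neg, map_ofNat]; ring]
        exact irreducible_X_sub_C _
      have hQb : Qb = X + 2 := eq_of_monic_of_associated hmon (by monicity!) (hirr.associated_of_dvd hirr1 h)
      have hPeq := hspan (X + C 2) (by rw [hQb]; simp [map_ofNat])
      rw [show aeval (thetaInt hα) (X + C 2 : ℤ[X]) = thetaInt hα + 2 by
          simp only [map_add, aeval_X, aeval_C, algebraMap_int_eq, Int.coe_castRingHom, Int.cast_ofNat], Nat.cast_ofNat, span_7_lin2_eq hα] at hPeq
      exact ⟨⟨-1 - thetaInt hα - 2 * thetaInt hα ^ 2, by rw [hPeq, Ideal.submodule_span_eq]⟩⟩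
  · have hirr1 : Irreducible (X + 1 : (ZMod 7)[X]) := by
      rw [show (X + 1 : (ZMod 7)[X]) = X - C (-1) by rw [map_neg, map_one, sub_neg_eq_add]]
      exact irreducible_X_sub_C _
    have hQb : Qb = X + 1 := eq_of_monic_of_associated hmon (by monicity!) (hirr.associated_of_dvd hirr1 h)
    have hPeq := hspan (X + 1) (by rw [hQb]; simp)
    rw [show aeval (thetaInt hα) (X + 1 : ℤ[X]) = thetaInt hα + 1 by
        simp only [map_add, aeval_X, map_one], Nat.cast_ofNat, span_7_lin1_eq hα] at hPeq
    exact ⟨⟨-1 - thetaInt hα, by rw [hPeq, Ideal.submodule_span_eq]⟩⟩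

/-! ## §4 Class number one -/

/-- **`𝓞_F` is a principal ideal domain.**  Minkowski: every ideal class contains an ideal of norm
`≤ (4/π)(6/27)√1259 < 11`, and the primes `P` above `p ≤ 10` with `p^f ≤ 10` are principal (§3).
[cite: LMFDB, number field 3.1.1259.1 (class number 1)] [cite: Marcus2018, Ch. 5, Thm. 37 and Cor. 2] -/
theorem isPrincipalIdealRing (h3 : finrank ℚ F = 3) (hα : aeval α (poly (-5) (-1) (-2)) = 0) : IsPrincipalIdealRing (𝓞 F) := by
  apply RingOfIntegers.isPrincipalIdealRing_of_isPrincipal_of_pow_le_of_mem_primesOver_of_mem_Icc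
  rw [nrComplexPlaces_eq_one h3 hα, h3, discr_eq h3 hα]
  intro p hp hpr P hP hle
  obtain ⟨hp1, hpM⟩ := Finset.mem_Icc.mp hp
  have hreal : (4 / π) ^ 1 * ((((3 : ℕ).factorial : ℕ) : ℝ) / ((3 : ℕ) : ℝ) ^ (3 : ℕ) * √|((-1259 : ℤ) : ℝ)|) < ((11 : ℕ) : ℝ) := by
    have hπ := Real.pi_gt_d2
    have hπ0 := Real.pi_pos
    have hs : √(1259 : ℝ) < 35.49 := by
      rw [Real.sqrt_lt' (by norm_num)]; norm_num
    have hs0 : 0 ≤ √(1259 : ℝ) := Real.sqrt_nonneg _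
    have habs : |((-1259 : ℤ) : ℝ)| = 1259 := by norm_num
    rw [habs]
    norm_num [Nat.factorial]
    rw [div_mul_eq_mul_div, div_lt_iff₀ hπ0]
    nlinarith
  have hfl := Nat.lt_succ_iff.mp ((Nat.floor_lt' (by norm_num)).mpr hreal)
  have hpB : p ≤ 10 := hpM.trans hfl
  have hleB : p ^ P.inertiaDeg ℤ ≤ 10 := hle.trans hfl
  clear hpM hle hp
  interval_cases p
  · exact absurd hpr (by norm_num)
  · exact isPrincipal_of_mem_primesOver_2 h3 hα hP
  · exact isPrincipal_of_mem_primesOver_3 h3 hα hP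
  · exact absurd hpr (by norm_num)
  · exact isPrincipal_of_mem_primesOver_5 h3 hα hP
  · exact absurd hpr (by norm_num)
  · exact isPrincipal_of_mem_primesOver_7 h3 hα hP
  · exact absurd hpr (by norm_num)
  · exact absurd hpr (by norm_num)
  · exact absurd hpr (by norm_num)

/-- ★ **`h_F = 1`: the cubic field of discriminant `−1259` has class number one.** [cite: LMFDB, number field 3.1.1259.1 (class number 1)] -/
theorem classNumber_eq_one (h3 : finrank ℚ F = 3) (hα : aeval α (poly (-5) (-1) (-2)) = 0) : classNumber F = 1 :=
  (classNumber_eq_one_iff (K := F)).mpr (isPrincipalIdealRing h3 hα)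

/-- **`h_F` is odd** (the form consumed by the `2`-adic doors of cell `bsd-f1-sign2`). [cite: LMFDB, number field 3.1.1259.1 (class number 1)] -/
theorem not_two_dvd_classNumber (h3 : finrank ℚ F = 3) (hα : aeval α (poly (-5) (-1) (-2)) = 0) : ¬ 2 ∣ classNumber F := by
  rw [classNumber_eq_one h3 hα]; decide

end NumberField

end Literature.NumberTheory.CubicFields.CubicDisc1259

end
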